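import Summits.QuantumFields.YangMills.Theorems.LangevinControlUVFemtoCurvatureSkewnessDefs

/-!
# Route `LangevinControlUV`, crux `FemtoCurvatureSkewness` (stmt-QuantumFields-9365): the ∃-bundled form is assembly-sufficient

Lead c2 of line `coupling-cubic-response` (prover-line-stmt-QuantumFields-9365-c2-0, 2026-08-16), `--supports stmt-QuantumFields-9365`.

The typed crux is `∀ G simple, ∀ r, ∀ a, TwoPointPackage r a → SkewnessPackage r a` (definitionally,
`femtoCurvatureSkewness_iff`).  Its ∃-bundled (R1) form `SkewnessForPackageMap`
(`Theorems/LangevinControlUVFemtoCurvatureSkewnessDefs.lean`: `(∃ a, TwoPointPackage r a) → ∃ a, TwoPointPackage r a ∧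
SkewnessPackage r a`) is what every line on this crux certifies modulo its UV engine alone (`skewnessForPackageMap_of`,
`…Reduction.lean` p111143), while the typed `∀ a` shell additionally demands, modulo the covariance uniformities of
`Negative/WildPackage.lean`, global non-vanishing of `κ₃` in ALL volumes (`FemtoCurvatureSkewness_false_of_UniformZeros`,
`not_globalSkewSign_of_uniformZeros`).  This file records, kernel-checked, the two facts a planner needs in order to RESTATE the
item as R1 without touching the rest of the route:

* `skewnessForPackageMap_of_femtoCurvatureSkewness`: the typed crux implies R1 (R1 is a weakening, not a different claim);
* `yangMills_of_R1`: the route's deciding chain goes through VERBATIM with R1 in place of the typed crux —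
  `FemtoCurvatureTwoPoint → SkewnessForPackageMap → LatticeGapInUVUnits → OSLegsFromFemtoAndGap → GapToContinuum → YangMills`
  (the infrared and OS legs are `∀ a`-statements, so they are simply evaluated at the package map R1 returns; `FemtoPoincare` is
  logically unused by `closes` already).  Pure logic over the route file; CONDITIONAL on the route's items exactly as `closes` is;
  nothing is asserted.
-/

set_option autoImplicit false

noncomputable section

namespace Summit.QuantumFields.YangMills.Cruxes.FemtoCurvatureSkewness.CouplingCubicResponse

open MeasureTheory Filter Topology
open Literature.MathematicalPhysics.QuantumFieldTheory
open Summit.QuantumFields.YangMills.Theses.LangevinControlUV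
  (FemtoCurvatureTwoPoint FemtoCurvatureSkewness LatticeGapInUVUnits OSLegsFromFemtoAndGap GapToContinuum)
open Summit.QuantumFields.YangMills.Theorems.FemtoCurvatureSkewness.Negative
  (TwoPointPackage SkewnessPackage)

/-- **The typed crux implies its ∃-bundled form** (R1 is a weakening): apply the `∀ a` statement to the given package map. -/
theorem skewnessForPackageMap_of_femtoCurvatureSkewness : Summit.QuantumFields.YangMills.Theses.LangevinControlUV.FemtoCurvatureSkewness → Summit.QuantumFields.YangMills.Cruxes.FemtoCurvatureSkewness.CouplingCubicResponse.SkewnessForPackageMap := by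
  intro h G _ _ _ _ hG
  letI : MeasurableSpace G := borel G
  haveI : BorelSpace G := ⟨rfl⟩
  intro r hex
  obtain ⟨a, ha⟩ := hex
  exact ⟨a, ha, h G hG r a ha⟩

-- buildfix 2026-08-19 (maintenance): `yangMills_of_R1 : FemtoCurvatureTwoPoint → SkewnessForPackageMap → LatticeGapInUVUnits →
-- OSLegsFromFemtoAndGap → GapToContinuum → YangMills` REMOVED — the YangMills Statement re-type (2026-08-16, p116790) added
-- `sch.HasWeakCouplingLimit` to the conclusion, which `OSLegsFromFemtoAndGap` (stmt-QuantumFields-9367, verdict misstated; C′ =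
-- OSLegsAtWeakCoupling stmt-16110) does not supply; the implication as stated is no longer derivable. The R1 weakening lemma
-- `skewnessForPackageMap_of_femtoCurvatureSkewness` above is untouched.

end Summit.QuantumFields.YangMills.Cruxes.FemtoCurvatureSkewness.CouplingCubicResponse

end
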